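import Mathlib
import HarnessLib
import Literature.Computability.AlgebraicComplexity.PatternExpressions
import Summits.ValiantsHypothesis.ValiantsHypothesis.Theorems.MonotoneRestorationMonotoneRestorationQPLinearWidthDefs
import Summits.ValiantsHypothesis.ValiantsHypothesis.Theorems.MonotoneRestorationMonotoneRestorationQPLinearWidthDeterminedVsNarrow
import Summits.ValiantsHypothesis.ValiantsHypothesis.Theorems.MonotoneRestorationMonotoneRestorationQPLinearWidthIsolationAnyLevel
import Summits.ValiantsHypothesis.ValiantsHypothesis.Theorems.MonotoneRestorationMonotoneRestorationQPLinearWidthSmallWitnessRung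
import Summits.ValiantsHypothesis.ValiantsHypothesis.Theorems.MonotoneRestorationMonotoneRestorationQPLinearWidthSmallWitnessSimpleGraph
import Summits.ValiantsHypothesis.ValiantsHypothesis.Theorems.MonotoneRestorationOrbitRestorationQPPerNotNarrow

/-!
# Route MonotoneRestoration, crux `MonotoneRestorationQP` (stmt-15886), line `linear_width` —
# THE SQUARE-ROOT RUNG `θ_{1/2}`: `WidthRung (fun n => Nat.sqrt n)` modulo the small-witness hypothesis (W1)

Helper file (`--supports stmt-ValiantsHypothesis-15886`), def-free.

The graded family of the line is `WidthRung d` (`…LinearWidthDefs.lean`): every matrix-symmetric `VP` family of degree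
`≤ d n` that is `PolylogHomDetermined` has `QPOrbitSymm`.  Proved floor `θ₀`: `d = polylog` (`widthRung_polylogDegree`);
open rung `θ₁`: `d n = c·(n+1)` (`stub_linearDegreeWidthRestoration`).  `SmallWitnessRung.qpOrbitSymm_of_smallWitness`
(p840965) gives `QPOrbitSymm` for every family of degree `≤ n / g(polylog_f n)` modulo the small-witness distinguishing
hypothesis (W1)_g — a degree budget depending on the family's width constant.  This file removes that dependence at
the price of a fixed sublinear budget and lands a genuine NEW RUNG OF THE LADDER in its own format:

* `exists_polylog_le_two_pow` — `(L + a)^b ≤ 2^L` for all large `L` (polynomial versus exponential, from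
  `tendsto_pow_const_div_const_pow_of_one_lt`);
* `mem_narrowSpan_of_smallWitness_at` — per-level narrowness under the weighted (W1)_g (any `g`): if
  `deg f_N · g((log₂ N + c₀)^c₀) ≤ N` then `f_N ∈ span{hom_F : tw F < g((log₂ N + c₀)^c₀)}`;
* `widthRung_sqrt_of_smallWitness` — **THE SQUARE-ROOT RUNG `θ_{1/2}` MODULO (W1)_g** (`g` polynomially bounded):
  `WidthRung (fun n => Nat.sqrt n)`.  Large levels: `√n · g(polylog n) ≤ n` eventually, so the small-witness isolation
  applies; small levels: every matrix-symmetric polynomial is narrow at width `≥ 2n − 1`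
  (`DeterminedVsNarrow.mem_narrowSpan_of_le`); both feed K2/K3 `qpOrbit_of_mem_narrowSpan`.  `IsVPFamily` idle.
* `widthRung_sqrt_of_simpleGraphSmallWitness` — the same with the simple-graph input (W1-simple)_g
  (`SmallWitnessRung.smallWitness_of_simpleGraphWitness`).

Status of the input (honest label, see the STATUS section of `…LinearWidthSmallWitnessSimpleGraph.lean`): (W1-simple)_g is
Dawar–Pago–Seppelt 2025 Thm 7.3 (+ Prop 7.4, Dvořák) for a NON-EXPLICIT `g` (Robertson–Seymour); the POLYNOMIAL `g` this
rung needs is NOT in print.  So: a conditional rung strictly between `θ₀` and `θ₁`; no stub closed; `θ₁`, the cruxes and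
VP ≠ VNP are NOT moved.
[cite: DawarPagoSeppelt2025, Thm 7.3, Thm 7.9, Thm 7.11; DawarWilsenach2025, §3.3; DwivediPagoSeppelt2026, Lemma 8.18]
-/

set_option linter.dupNamespace false

noncomputable section

open scoped Classical

namespace Summit.ValiantsHypothesis.ValiantsHypothesis.Theorems.SqrtRung

open MvPolynomial Finset Filter
open Literature.Computability.AlgebraicComplexity
open Summit.ValiantsHypothesis.ValiantsHypothesis.Theorems.MonotoneRestorationQPLinearWidth
open Summit.ValiantsHypothesis.ValiantsHypothesis.Theorems.IsolationAnyLevel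
open Summit.ValiantsHypothesis.ValiantsHypothesis.Theorems.SmallWitnessRung

/-! ### Polylogarithms are eventually below powers -/

/-- **Polynomial versus exponential**: `(L + a)^b ≤ 2^L` for all sufficiently large `L`. [folklore] -/
theorem exists_polylog_le_two_pow (a b : ℕ) : ∃ L₀ : ℕ, ∀ L : ℕ, L₀ ≤ L → (L + a) ^ b ≤ 2 ^ L := by
  have h := tendsto_pow_const_div_const_pow_of_one_lt (a + b) (one_lt_two (α := ℝ))
  have hev : ∀ᶠ n : ℕ in atTop, ((n : ℝ) ^ (a + b) / 2 ^ n) < 1 := h.eventually (gt_mem_nhds zero_lt_one)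
  obtain ⟨L₁, hL₁⟩ := Filter.eventually_atTop.1 hev
  refine ⟨L₁ + 2, fun L hL => ?_⟩
  have hn : L₁ ≤ L + a := by omega
  have hlt := hL₁ (L + a) hn
  rw [div_lt_one (by positivity)] at hlt
  -- `(L+a)^(a+b) < 2^(L+a)` as naturals
  have hnat : (L + a) ^ (a + b) < 2 ^ (L + a) := by exact_mod_cast hlt
  -- `2^a · (L+a)^b ≤ (L+a)^a · (L+a)^b = (L+a)^(a+b) < 2^a · 2^L`
  have h2 : 2 ^ a ≤ (L + a) ^ a := Nat.pow_le_pow_left (by omega) a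
  have key : 2 ^ a * (L + a) ^ b < 2 ^ a * 2 ^ L := by
    calc 2 ^ a * (L + a) ^ b ≤ (L + a) ^ a * (L + a) ^ b := Nat.mul_le_mul_right _ h2
      _ = (L + a) ^ (a + b) := (pow_add _ _ _).symm
      _ < 2 ^ (L + a) := hnat
      _ = 2 ^ a * 2 ^ L := by rw [pow_add, mul_comm]
  exact (Nat.lt_of_mul_lt_mul_left key).le

/-! ### Per-level narrowness under the weighted small-witness hypothesis -/

/-- **Per-level narrowness under (W1)_g** (any `g`): if `f` is matrix-symmetric, determined at width `(log₂ N + c₀)^c₀`, and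
`deg f_N · g((log₂ N + c₀)^c₀) ≤ N`, then `f_N` lies in the span of the `hom_{F,N}` with `tw F < g((log₂ N + c₀)^c₀)`.
[cite: DawarPagoSeppelt2025, Thm 7.9, §7.1.1] -/
theorem mem_narrowSpan_of_smallWitness_at (g : ℕ → ℕ)
    (hW1 : ∀ (k a b : ℕ) (E : Multiset (Fin a × Fin b)),
      (∀ u : Fin a, ∃ x ∈ E, x.1 = u) → (∀ v : Fin b, ∃ x ∈ E, x.2 = v) →
      g k ≤ Literature.Combinatorics.SimpleGraph.treewidth (patternGraph E) →
      ∃ z z' : Fin (g k) × Fin (g k) → ℂ, HomIndist (g k) k z z' ∧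
        eval z (homPoly E (g k) ℂ) ≠ eval z' (homPoly E (g k) ℂ))
    (f : (n : ℕ) → MvPolynomial (Fin n × Fin n) ℂ) (hsym : IsMatrixSymmetric f) (c₀ : ℕ)
    (hdet : ∀ (n : ℕ) (A B : Fin n × Fin n → ℂ), HomIndist n ((Nat.log 2 n + c₀) ^ c₀) A B →
      eval A (f n) = eval B (f n))
    (N : ℕ) (hdeg : (f N).totalDegree * g ((Nat.log 2 N + c₀) ^ c₀) ≤ N) :
    f N ∈ Submodule.span ℂ
      {q : MvPolynomial (Fin N × Fin N) ℂ | ∃ (a b : ℕ) (E : Multiset (Fin a × Fin b)),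
        Literature.Combinatorics.SimpleGraph.treewidth
            (SimpleGraph.fromRel fun u v : Fin a ⊕ Fin b => ∃ e ∈ E, u = Sum.inl e.1 ∧ v = Sum.inr e.2) <
              g ((Nat.log 2 N + c₀) ^ c₀) ∧
          q = homPoly E N ℂ} := by
  obtain ⟨M, a, b, E, α, -, hdeg', -, hrow, hcol, hiso, hfe⟩ :=
    exists_nonIso_expansion_of_matrixSymmetric (f N) (hsym N)
  have hdet' : ∀ A B : Fin N × Fin N → ℂ, HomIndist N ((Nat.log 2 N + c₀) ^ c₀) A B →
      eval A (∑ i, C (α i) * homPoly (E i) N ℂ) = eval B (∑ i, C (α i) * homPoly (E i) N ℂ) := by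
    intro A B hAB
    rw [← hfe]
    exact hdet N A B hAB
  rw [hfe]
  exact mem_narrowSpan_of_determined_of_distinguishable₂ (K := g ((Nat.log 2 N + c₀) ^ c₀)) hdeg a b E α hdeg'
    hrow hcol hiso hdet' fun i hk => hW1 _ (a i) (b i) (E i) (hrow i) (hcol i) hk

/-! ### The square-root rung -/

/-- **THE SQUARE-ROOT RUNG `θ_{1/2}` MODULO (W1)_g.**  Assume the weighted small-witness distinguishing hypothesis
(W1)_g with `g k ≤ (k+2)^e`.  Then `WidthRung (fun n => Nat.sqrt n)`: every matrix-symmetric `VP` family of degree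
`≤ √n` that is `PolylogHomDetermined` has square-symmetric circuits of quasi-polynomial orbit size.  (For
`n ≥ N₀(f)`: `√n · g((log₂ n + c₀)^c₀) ≤ n`, so `mem_narrowSpan_of_smallWitness_at` makes `f_n` narrow at a polylogarithmic
width; for `n < N₀`: narrow for free at width `≥ 2n − 1`; K2/K3 compile.) [cite: DawarPagoSeppelt2025, Thm 7.9; DawarWilsenach2025, §3.3] -/
theorem widthRung_sqrt_of_smallWitness (g : ℕ → ℕ) (e : ℕ) (hg : ∀ k, g k ≤ (k + 2) ^ e)
    (hW1 : ∀ (k a b : ℕ) (E : Multiset (Fin a × Fin b)),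
      (∀ u : Fin a, ∃ x ∈ E, x.1 = u) → (∀ v : Fin b, ∃ x ∈ E, x.2 = v) →
      g k ≤ Literature.Combinatorics.SimpleGraph.treewidth (patternGraph E) →
      ∃ z z' : Fin (g k) × Fin (g k) → ℂ, HomIndist (g k) k z z' ∧
        eval z (homPoly E (g k) ℂ) ≠ eval z' (homPoly E (g k) ℂ)) :
    WidthRung fun n => Nat.sqrt n := by
  intro f hsym _hVP hdeg hdet
  obtain ⟨c₀, hdet⟩ := hdet
  -- one polylogarithm dominating `g((log₂ n + c₀)^c₀)`, and the level from which its square is `≤ n`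
  obtain ⟨c', hc'⟩ := exists_polylog_dominates c₀ e
  obtain ⟨L₀, hL₀⟩ := exists_polylog_le_two_pow c' (2 * c')
  -- the width exponent: `c''` dominates `c'` and makes small levels free
  refine ⟨max c' (2 * 2 ^ L₀ + 1) + 3,
    OrbitRestorationQPHomPolyClose.qpOrbit_of_mem_narrowSpan f (max c' (2 * 2 ^ L₀ + 1)) (fun n => ?_)⟩
  by_cases hn : 2 ^ L₀ ≤ n
  · -- large level: isolation + small witnesses
    have hL : L₀ ≤ Nat.log 2 n := Nat.le_log_of_pow_le one_lt_two hn
    have hn0 : n ≠ 0 := by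
      have := Nat.one_le_two_pow (n := L₀)
      omega
    have hP : (Nat.log 2 n + c') ^ c' ≤ Nat.sqrt n := by
      rw [Nat.le_sqrt']
      calc ((Nat.log 2 n + c') ^ c') ^ 2 = (Nat.log 2 n + c') ^ (2 * c') := by rw [← pow_mul, mul_comm]
        _ ≤ 2 ^ Nat.log 2 n := hL₀ _ hL
        _ ≤ n := Nat.pow_log_le_self 2 hn0
    have hgk : g ((Nat.log 2 n + c₀) ^ c₀) ≤ (Nat.log 2 n + c') ^ c' := (hg _).trans (hc' _)
    have hbudget : (f n).totalDegree * g ((Nat.log 2 n + c₀) ^ c₀) ≤ n :=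
      calc (f n).totalDegree * g ((Nat.log 2 n + c₀) ^ c₀) ≤ Nat.sqrt n * Nat.sqrt n :=
            Nat.mul_le_mul (hdeg n) (hgk.trans hP)
        _ ≤ n := Nat.sqrt_le n
    refine Submodule.span_mono ?_ (mem_narrowSpan_of_smallWitness_at g hW1 f hsym c₀ hdet n hbudget)
    rintro q ⟨a', b', E', htw, rfl⟩
    refine ⟨a', b', E', ?_, rfl⟩
    calc Literature.Combinatorics.SimpleGraph.treewidth _ ≤ (Nat.log 2 n + c') ^ c' := (htw.trans_le hgk).le
      _ ≤ (Nat.log 2 n + max c' (2 * 2 ^ L₀ + 1)) ^ (max c' (2 * 2 ^ L₀ + 1)) :=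
          (Nat.pow_le_pow_left (by omega) _).trans
            (Nat.pow_le_pow_right (by omega) (le_max_left _ _))
  · -- small level: everything matrix-symmetric is narrow at width `≥ 2n - 1`
    refine DeterminedVsNarrow.mem_narrowSpan_of_le ?_ (f n) (hsym n)
    push Not at hn
    calc 2 * n - 1 ≤ 2 * 2 ^ L₀ + 1 := by omega
      _ ≤ max c' (2 * 2 ^ L₀ + 1) := le_max_right _ _
      _ ≤ (Nat.log 2 n + max c' (2 * 2 ^ L₀ + 1)) ^ 1 := by simp
      _ ≤ (Nat.log 2 n + max c' (2 * 2 ^ L₀ + 1)) ^ (max c' (2 * 2 ^ L₀ + 1)) :=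
          Nat.pow_le_pow_right (by omega) (by omega)

/-- **The square-root rung with the simple-graph input (W1-simple)_g.** [cite: DawarPagoSeppelt2025, Thm 7.3, Thm 7.9; Dvorak2010, Thm 6] -/
theorem widthRung_sqrt_of_simpleGraphSmallWitness (g : ℕ → ℕ) (e : ℕ) (hg : ∀ k, g k ≤ (k + 2) ^ e)
    (hW : ∀ (k a b : ℕ) (E : Multiset (Fin a × Fin b)),
      (∀ u : Fin a, ∃ x ∈ E, x.1 = u) → (∀ v : Fin b, ∃ x ∈ E, x.2 = v) →
      g k ≤ Literature.Combinatorics.SimpleGraph.treewidth (patternGraph E) →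
      ∃ X Y : SimpleGraph (Fin (g k)), Literature.ModelTheory.FiniteModelTheory.CkEquiv k X Y ∧
        Nat.card (patternGraph E →g X) ≠ Nat.card (patternGraph E →g Y)) :
    WidthRung fun n => Nat.sqrt n :=
  widthRung_sqrt_of_smallWitness g e hg
    fun k a b E hrow hcol htw => smallWitness_of_simpleGraphWitness g hW k a b E hrow hcol htw

end Summit.ValiantsHypothesis.ValiantsHypothesis.Theorems.SqrtRung

end
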